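import Summits.AtomisticToContinuum.BoseEinsteinCondensation.Theses.BECStronglyRayleigh
import Summits.AtomisticToContinuum.BoseEinsteinCondensation.Theorems.InsertionFieldDelocalisation.Negative.Toolkit
import Summits.AtomisticToContinuum.BoseEinsteinCondensation.Theorems.InsertionFieldDelocalisation.Negative.Tightness
import Summits.AtomisticToContinuum.BoseEinsteinCondensation.Theorems.BECStronglyRayleighSectorGroundStatePerron
import HarnessLib

/-!
# Negative lemmas for crux `InsertionFieldDelocalisation` (stmt-AtomisticToContinuum-9673), VI:
# the eigen-equation is load-bearing in `stub_voidTail` of line `mobile-trap-dirichlet-eigenfunction`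

Supports (does not close) stmt-AtomisticToContinuum-9673; nothing here asserts a Theses statement or a
stub positively (drefute seat).  `stub_voidTail` of `Cruxes/InsertionFieldDelocalisation/Lines/
mobile_trap_dirichlet_eigenfunction.lean` concludes `VoidTail'`: under the size-biased weights
`W(T,x) = (r^T_x)²` the void radius `ρ_T(x) = min_{t∈T} dist(x,t)` exceeds `R` with weight at most
`C₁ e^{-c₁ (N/L³) R³}` of the total.

* `torusDepth_le_dist` — toolkit (also for the provers of `stub_voidTail` / `stub_transfer`): the graph
  distance on `(ℤ/Lℤ)³` from the origin is at least the cyclic depth `min(t₀, L - t₀)` of the first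
  coordinate (a 1-Lipschitz function along torus edges, induction on walks).
* `voidTail_false_without_groundState` — delete `Hψ = E_min ψ` (keep sector, `ψ ≠ 0`, nonnegativity,
  `2 ≤ N ≤ L³/2`): FALSE.  Witness for given `C₁`, `c₁ > 0`: `L = 4N`, `R = N`, `ψ = δ_{1_S}`,
  `S = {0} ∪ K`, `K` = the `N - 1` far-slab sites `(2N, j, 0)`, `j < N - 1`; each `T = K ∖ {k}` leaves
  the origin in a void of radius `≥ 2N > R` with `r^T_0 ≥ 1`, so the void weight is `≥ N - 1`, the
  total weight is `≤ N⁵`, and `C₁ N⁵ e^{-c₁N/64} < N - 1` for large `N` (`exists_large_N`).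
  (The filling restriction `2N ≤ L³`, by contrast, is not visibly load-bearing for `VoidTail'`: near
  full filling voids are impossible.)
-/

noncomputable section

namespace Summit.AtomisticToContinuum.BoseEinsteinCondensation.Theorems.InsertionFieldDelocalisation.Negative

open scoped BigOperators ComplexOrder
open Literature.MathematicalPhysics.QuantumLattice Literature.Probability.LatticeModels Matrix Finset
open Summit.AtomisticToContinuum.BoseEinsteinCondensation.Theses.BECStronglyRayleigh
open Summit.AtomisticToContinuum.BoseEinsteinCondensation.Theorems.BECStronglyRayleighSectorPerron
  (torusGraph_connected)

/-! ### A lower bound for the graph distance on the torus: the depth of the first coordinate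

`depth(z) = min(z.val, L - z.val)` is the distance from `z ∈ ℤ/Lℤ` to `0` along the cycle; it is
1-Lipschitz along torus edges, whence `dist(0, t) ≥ depth(t 0)`. (Kept def-free.) -/

/-- One step `z ↦ z + 1` changes the depth by at most one (both directions). [folklore] -/
theorem torusDepth_add_one {L : ℕ} (hL : 2 ≤ L) (z : ZMod L) :
    min (z + 1).val (L - (z + 1).val) ≤ min z.val (L - z.val) + 1 ∧
      min z.val (L - z.val) ≤ min (z + 1).val (L - (z + 1).val) + 1 := by
  haveI : NeZero L := ⟨by omega⟩
  haveI : Fact (1 < L) := ⟨hL⟩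
  have hv : (z + 1).val = (z.val + 1) % L := by rw [ZMod.val_add, ZMod.val_one]
  have hz : z.val < L := ZMod.val_lt z
  by_cases h : z.val + 1 < L
  · rw [Nat.mod_eq_of_lt h] at hv; rw [hv]; omega
  · rw [show z.val + 1 = L by omega, Nat.mod_self] at hv; rw [hv]; omega

/-- Along an edge of the torus graph the first-coordinate depth changes by at most one. [folklore] -/
theorem torusDepth_le_of_adj {L : ℕ} (hL : 2 ≤ L) {u w : TorusSite 3 L}
    (h : (torusGraph 3 L).Adj u w) :
    min (w 0).val (L - (w 0).val) ≤ min (u 0).val (L - (u 0).val) + 1 := by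
  rw [torusGraph_adj_iff] at h
  obtain ⟨-, ⟨i, hi⟩ | ⟨i, hi⟩⟩ := h
  · have : w 0 = u 0 + (Pi.single i (1 : ZMod L) : TorusSite 3 L) 0 := by rw [hi]; rfl
    by_cases hi0 : i = 0
    · subst hi0; rw [this, Pi.single_eq_same]; exact (torusDepth_add_one hL _).1
    · rw [this, Pi.single_eq_of_ne (Ne.symm hi0), add_zero]; omega
  · have : u 0 = w 0 + (Pi.single i (1 : ZMod L) : TorusSite 3 L) 0 := by rw [hi]; rfl
    by_cases hi0 : i = 0
    · subst hi0; rw [this, Pi.single_eq_same]; exact (torusDepth_add_one hL _).2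
    · rw [this, Pi.single_eq_of_ne (Ne.symm hi0), add_zero]; exact Nat.le_succ _

/-- Along a walk the depth grows by at most the length. [folklore] -/
theorem torusDepth_le_add_length {L : ℕ} (hL : 2 ≤ L) :
    ∀ {u v : TorusSite 3 L} (p : (torusGraph 3 L).Walk u v),
      min (v 0).val (L - (v 0).val) ≤ min (u 0).val (L - (u 0).val) + p.length := by
  intro u v p
  induction p with
  | nil => simp
  | cons h p ih => rw [SimpleGraph.Walk.length_cons]; have := torusDepth_le_of_adj hL h; omega

/-- **Distance lower bound on the torus**: `dist(0, t) ≥ min(t₀, L - t₀)`, the cyclic depth of the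
first coordinate. [folklore] -/
theorem torusDepth_le_dist {L : ℕ} (hL : 2 ≤ L) (t : TorusSite 3 L) :
    min (t 0).val (L - (t 0).val) ≤ (torusGraph 3 L).dist 0 t := by
  haveI : NeZero L := ⟨by omega⟩
  obtain ⟨p, hp⟩ :=
    ((torusGraph_connected 3 L).preconnected (0 : TorusSite 3 L) t).exists_walk_length_eq_dist
  have h := torusDepth_le_add_length hL p
  rw [hp] at h
  have h0 : ((0 : TorusSite 3 L) 0).val = 0 := ZMod.val_zero
  rw [h0] at h
  omega

/-! ### `VoidTail'` without the eigen-equation -/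


/-- Polynomials lose against exponentials: for `c > 0` there are arbitrarily large `N` with
`C N⁵ e^{-cN/64} < N - 1`. [folklore] -/
theorem exists_large_N (C c : ℝ) (hc : 0 < c) (N₀ : ℕ) :
    ∃ N : ℕ, N₀ ≤ N ∧ 3 ≤ N ∧ C * (N : ℝ) ^ 5 * Real.exp (-(c * N / 64)) < (N : ℝ) - 1 := by
  set A : ℝ := 720 * 64 ^ 6 * |C| / c ^ 6 with hA
  have hA0 : 0 ≤ A := by rw [hA]; positivity
  obtain ⟨N, hN⟩ := exists_nat_gt (A + N₀ + 3)
  have hN₀ : (0 : ℝ) ≤ N₀ := Nat.cast_nonneg _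
  have hN3 : (3 : ℝ) ≤ N := by linarith
  refine ⟨N, by exact_mod_cast (show (N₀ : ℝ) ≤ N by linarith), by exact_mod_cast hN3, ?_⟩
  · have hNpos : (0 : ℝ) < N := by linarith
    set y : ℝ := c * N / 64 with hy
    have hypos : 0 < y := by rw [hy]; positivity
    have hexp : Real.exp (-y) ≤ 720 / y ^ 6 := by
      have h6 := Real.pow_div_factorial_le_exp y hypos.le 6
      have hfac : ((Nat.factorial 6 : ℕ) : ℝ) = 720 := by norm_num [Nat.factorial]
      rw [hfac] at h6
      rw [Real.exp_neg, inv_eq_one_div, div_le_div_iff₀ (Real.exp_pos y) (by positivity)]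
      rw [div_le_iff₀ (by norm_num : (0 : ℝ) < 720)] at h6
      linarith
    have hbound : C * (N : ℝ) ^ 5 * Real.exp (-y) ≤ A / N := by
      calc C * (N : ℝ) ^ 5 * Real.exp (-y) ≤ |C| * (N : ℝ) ^ 5 * Real.exp (-y) := by
            have : C ≤ |C| := le_abs_self C
            have h0 : 0 ≤ (N : ℝ) ^ 5 * Real.exp (-y) := by positivity
            nlinarith
        _ ≤ |C| * (N : ℝ) ^ 5 * (720 / y ^ 6) := by
            have h0 : 0 ≤ |C| * (N : ℝ) ^ 5 := by positivity
            exact mul_le_mul_of_nonneg_left hexp h0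
        _ = A / N := by rw [hA, hy]; field_simp
    have hAN : A / N < (N : ℝ) - 1 := by rw [div_lt_iff₀ hNpos]; nlinarith
    linarith

/-- **Any proof of `stub_voidTail` must use the eigen-equation.** Witness (given `C₁`, `c₁ > 0`):
`L = 4N`, `R = N`, `ψ = δ_{1_S}` with `S = {0} ∪ K`, `K` = `N - 1` sites of the far slab
`{k : k₀ = 2N}` (all at graph distance `≥ 2N > R` from `0`, `torusDepth_le_dist`). For `T = K ∖ {k}`
and `x = 0` the void radius exceeds `R` and `r^T_0 ≥ 1`, so the left side is `≥ N - 1`, while the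
total weight is `≤ N⁵` and the allowance `C₁ e^{-c₁ (N/L³) R³} N⁵ = C₁ N⁵ e^{-c₁N/64} < N - 1` for `N`
large (`exists_large_N`). [folklore] -/
theorem voidTail_false_without_groundState : ¬
    (∃ C₁ c₁ : ℝ, 0 < c₁ ∧ ∀ (L : ℕ) [NeZero L], 2 ≤ L → ∀ N : ℕ, 2 ≤ N → 2 * N ≤ L ^ 3 →
      ∀ ψ : TensorIndex (TorusSite 3 L) 2 → ℂ,
        ψ ∈ spinZSector 1 ((N : ℝ) - (L : ℝ) ^ 3 / 2) → ψ ≠ 0 →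
        (∀ σ, 0 ≤ (ψ σ).re ∧ (ψ σ).im = 0) → ∀ R : ℕ,
        (∑ T ∈ (Finset.univ : Finset (TorusSite 3 L)).powersetCard (N - 2), ∑ x : TorusSite 3 L,
            if R < ((T.image fun t => (torusGraph 3 L).dist x t).min.untopD 0) then
              field ψ T x ^ 2 else 0)
          ≤ C₁ * Real.exp (-(c₁ * ((N : ℝ) / (L : ℝ) ^ 3) * (R : ℝ) ^ 3)) *
            ∑ T ∈ (Finset.univ : Finset (TorusSite 3 L)).powersetCard (N - 2), ∑ x : TorusSite 3 L,
              field ψ T x ^ 2) := by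
  rintro ⟨C₁, c₁, hc₁, h⟩
  obtain ⟨N, -, hN3, hNbig⟩ := exists_large_N C₁ c₁ hc₁ 0
  set L : ℕ := 4 * N with hLdef
  have hL2 : 2 ≤ L := by omega
  haveI : NeZero L := ⟨by omega⟩
  have hN2 : 2 ≤ N := by omega
  have hNL : 2 * N ≤ L ^ 3 := by
    rw [hLdef]
    calc 2 * N ≤ 4 * N := by omega
      _ ≤ (4 * N) ^ 3 := Nat.le_self_pow (by norm_num) _
  -- the far coordinate value c = 2N (depth 2N)
  set c : ZMod L := ((2 * N : ℕ) : ZMod L) with hcdef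
  have hcval : c.val = 2 * N := by rw [hcdef, ZMod.val_cast_of_lt (by omega)]
  have hcdepth : min c.val (L - c.val) = 2 * N := by rw [hcval]; omega
  have hc0 : c ≠ 0 := by
    intro h0
    have := congrArg ZMod.val h0
    rw [hcval, ZMod.val_zero] at this
    omega
  -- the slab points k_j = (c, j, 0), j < N - 1
  set kpt : ℕ → TorusSite 3 L := fun j => ![c, ((j : ℕ) : ZMod L), 0] with hkpt
  have hkpt0 : ∀ j, kpt j 0 = c := fun j => by simp [hkpt]
  have hkpt1 : ∀ j, kpt j 1 = ((j : ℕ) : ZMod L) := fun j => by simp [hkpt]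
  have hinj : Set.InjOn kpt (Finset.range (N - 1) : Finset ℕ) := by
    intro j₁ hj₁ j₂ hj₂ hj
    have h1 := congrFun hj 1
    rw [hkpt1, hkpt1] at h1
    have hj₁L : j₁ < L := by
      have := Finset.mem_range.mp hj₁; omega
    have hj₂L : j₂ < L := by
      have := Finset.mem_range.mp hj₂; omega
    have := congrArg ZMod.val h1
    rwa [ZMod.val_cast_of_lt hj₁L, ZMod.val_cast_of_lt hj₂L] at this
  set K : Finset (TorusSite 3 L) := (Finset.range (N - 1)).image kpt with hKdef
  have hKcard : K.card = N - 1 := by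
    rw [hKdef, Finset.card_image_of_injOn hinj, Finset.card_range]
  have hK0 : ∀ k ∈ K, k 0 = c := by
    intro k hk
    obtain ⟨j, -, rfl⟩ := Finset.mem_image.mp hk
    exact hkpt0 j
  have h0K : (0 : TorusSite 3 L) ∉ K := by
    intro h0
    have := hK0 0 h0
    exact hc0 (by rw [← this]; rfl)
  set S : Finset (TorusSite 3 L) := insert 0 K with hSdef
  have hScard : S.card = N := by
    rw [hSdef, Finset.card_insert_of_notMem h0K, hKcard]; omega
  -- the witness vector
  set ψ : TensorIndex (TorusSite 3 L) 2 → ℂ :=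
    bvec (fun z => if z ∈ S then (0 : Fin 2) else 1) with hψdef
  have hsec : ψ ∈ spinZSector 1 ((N : ℝ) - (L : ℝ) ^ 3 / 2) := by
    refine bvec_ind_mem_spinZSector _ _ ?_
    rw [hScard, card_torusSite 3 L]
    push_cast
    ring
  have hnn : ∀ σ, 0 ≤ (ψ σ).re ∧ (ψ σ).im = 0 := bvec_nonneg _
  have hnn' : ∀ σ, 0 ≤ (ψ σ).re := fun σ => (hnn σ).1
  have key := h L hL2 N hN2 hNL ψ hsec (bvec_ne_zero _) hnn N
  set PC := (Finset.univ : Finset (TorusSite 3 L)).powersetCard (N - 2) with hPC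
  set g : Finset (TorusSite 3 L) → TorusSite 3 L → ℝ := fun T x =>
    if N < ((T.image fun t => (torusGraph 3 L).dist x t).min.untopD 0) then field ψ T x ^ 2 else 0
    with hgdef
  have hg0 : ∀ T x, 0 ≤ g T x := by
    intro T x
    simp only [hgdef]
    split_ifs
    · positivity
    · exact le_rfl
  have hTmem : ∀ k ∈ K, K.erase k ∈ PC := by
    intro k hk
    rw [hPC, Finset.mem_powersetCard]
    refine ⟨Finset.subset_univ _, ?_⟩
    rw [Finset.card_erase_of_mem hk, hKcard]
    omega
  have herase_inj : Set.InjOn (fun k => K.erase k) (K : Set (TorusSite 3 L)) := by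
    intro k₁ hk₁ k₂ hk₂ hk
    by_contra hne
    have : k₂ ∈ K.erase k₁ := Finset.mem_erase.mpr ⟨Ne.symm hne, hk₂⟩
    rw [show (fun k => K.erase k) k₁ = K.erase k₁ from rfl,
      show (fun k => K.erase k) k₂ = K.erase k₂ from rfl] at hk
    rw [hk] at this
    exact (Finset.notMem_erase k₂ K) this
  -- void radius of (K \ {k}, 0) exceeds N
  have hvoid : ∀ k ∈ K, N < (((K.erase k).image fun t => (torusGraph 3 L).dist 0 t).min.untopD 0) := by
    intro k hk
    have hne : (K.erase k).Nonempty := by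
      rw [← Finset.card_pos, Finset.card_erase_of_mem hk, hKcard]; omega
    obtain ⟨t₀, ht₀⟩ := hne
    obtain ⟨b, hb⟩ := Finset.min_of_mem (Finset.mem_image_of_mem (fun t => (torusGraph 3 L).dist 0 t) ht₀)
    rw [hb]
    change N < b
    obtain ⟨t, ht, htb⟩ := Finset.mem_image.mp (Finset.mem_of_min hb)
    rw [← htb]
    have htK : t ∈ K := Finset.mem_of_mem_erase ht
    have hdepth := torusDepth_le_dist hL2 t
    rw [hK0 t htK, hcdepth] at hdepth
    omega
  -- the field at (K \ {k}, 0) is ≥ 1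
  have hfield : ∀ k ∈ K, 1 ≤ field ψ (K.erase k) 0 := by
    intro k hk
    have h0T : (0 : TorusSite 3 L) ∉ K.erase k := fun h0 => h0K (Finset.mem_of_mem_erase h0)
    have hkT : k ∉ K.erase k := Finset.notMem_erase k K
    have h0k : (0 : TorusSite 3 L) ≠ k := fun h0 => h0K (h0 ▸ hk)
    have hle := le_field ψ hnn' (K.erase k) h0T hkT h0k
    have hS' : insert 0 (insert k (K.erase k)) = S := by
      rw [Finset.insert_erase hk]
    rw [hS', hψdef, bvec_ind_re, if_pos rfl] at hle
    exact hle
  have hlhs : ((N : ℝ) - 1) ≤ ∑ T ∈ PC, ∑ x : TorusSite 3 L, g T x := by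
    have h1 : ∑ T ∈ K.image (fun k => K.erase k), ∑ x : TorusSite 3 L, g T x ≤
        ∑ T ∈ PC, ∑ x : TorusSite 3 L, g T x := by
      apply Finset.sum_le_sum_of_subset_of_nonneg
      · intro T hT
        obtain ⟨k, hk, rfl⟩ := Finset.mem_image.mp hT
        exact hTmem k hk
      · intro T _ _
        exact Finset.sum_nonneg fun x _ => hg0 T x
    have h2 : ∑ T ∈ K.image (fun k => K.erase k), ∑ x : TorusSite 3 L, g T x =
        ∑ k ∈ K, ∑ x : TorusSite 3 L, g (K.erase k) x := Finset.sum_image herase_inj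
    have h3 : ∀ k ∈ K, (1 : ℝ) ≤ ∑ x : TorusSite 3 L, g (K.erase k) x := by
      intro k hk
      have hgk : 1 ≤ g (K.erase k) 0 := by
        simp only [hgdef]
        rw [if_pos (hvoid k hk)]
        have := hfield k hk
        nlinarith
      exact hgk.trans (Finset.single_le_sum (f := fun x => g (K.erase k) x) (fun x _ => hg0 _ x)
        (Finset.mem_univ _))
    have h4 : ((N : ℝ) - 1) ≤ ∑ k ∈ K, ∑ x : TorusSite 3 L, g (K.erase k) x := by
      have := Finset.card_nsmul_le_sum K (fun k => ∑ x : TorusSite 3 L, g (K.erase k) x) 1 h3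
      rw [hKcard, nsmul_eq_mul, mul_one] at this
      have hcast : (((N - 1 : ℕ)) : ℝ) = (N : ℝ) - 1 := by
        rw [Nat.cast_sub (by omega)]; simp
      rw [hcast] at this
      exact this
    linarith
  have hterm : ∀ (T : Finset (TorusSite 3 L)) (x y : TorusSite 3 L),
      (if x ∉ T ∧ y ∉ T ∧ x ≠ y then
          (ψ (fun z => if z ∈ insert x (insert y T) then 0 else 1)).re else 0) ≤
        (if x ∈ S ∧ T ⊆ S then (1 : ℝ) else 0) * (if y ∈ S then (1 : ℝ) else 0) := by
    intro T x y
    by_cases hc : x ∉ T ∧ y ∉ T ∧ x ≠ y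
    · rw [if_pos hc, hψdef, bvec_ind_re]
      by_cases hS' : insert x (insert y T) = S
      · have hx : x ∈ S := hS' ▸ Finset.mem_insert_self x _
        have hy : y ∈ S := hS' ▸ Finset.mem_insert_of_mem (Finset.mem_insert_self y T)
        have hT : T ⊆ S := fun t ht =>
          hS' ▸ Finset.mem_insert_of_mem (Finset.mem_insert_of_mem ht)
        rw [if_pos hS', if_pos ⟨hx, hT⟩, if_pos hy]; norm_num
      · rw [if_neg hS']
        split_ifs <;> norm_num
    · rw [if_neg hc]
      split_ifs <;> norm_num
  have hfield_le : ∀ (T : Finset (TorusSite 3 L)) (x : TorusSite 3 L),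
      field ψ T x ≤ (if x ∈ S ∧ T ⊆ S then (1 : ℝ) else 0) * N := by
    intro T x
    rw [field]
    calc (∑ y, if x ∉ T ∧ y ∉ T ∧ x ≠ y then
            (ψ (fun z => if z ∈ insert x (insert y T) then 0 else 1)).re else 0)
        ≤ ∑ y, (if x ∈ S ∧ T ⊆ S then (1 : ℝ) else 0) * (if y ∈ S then (1 : ℝ) else 0) :=
          Finset.sum_le_sum fun y _ => hterm T x y
      _ = (if x ∈ S ∧ T ⊆ S then (1 : ℝ) else 0) * N := by
          rw [← Finset.mul_sum, Finset.sum_boole]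
          congr 1
          have : (Finset.univ.filter fun y : TorusSite 3 L => y ∈ S) = S := by ext y; simp
          rw [this, hScard]
  have hsq_le : ∀ (T : Finset (TorusSite 3 L)) (x : TorusSite 3 L),
      field ψ T x ^ 2 ≤ (if x ∈ S ∧ T ⊆ S then (1 : ℝ) else 0) * (N : ℝ) ^ 2 := by
    intro T x
    have h0 := field_nonneg ψ hnn' T x
    have h1 := hfield_le T x
    calc field ψ T x ^ 2 ≤ ((if x ∈ S ∧ T ⊆ S then (1 : ℝ) else 0) * N) ^ 2 :=
          pow_le_pow_left₀ h0 h1 2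
      _ = (if x ∈ S ∧ T ⊆ S then (1 : ℝ) else 0) * (N : ℝ) ^ 2 := by
          split_ifs <;> ring
  have hPCfilter : PC.filter (fun T => T ⊆ S) = S.powersetCard (N - 2) := by
    ext T
    rw [hPC, Finset.mem_filter, Finset.mem_powersetCard, Finset.mem_powersetCard]
    constructor
    · rintro ⟨⟨-, hc⟩, hs⟩; exact ⟨hs, hc⟩
    · rintro ⟨hs, hc⟩; exact ⟨⟨Finset.subset_univ _, hc⟩, hs⟩
  have hchoose : ((S.powersetCard (N - 2)).card : ℝ) ≤ (N : ℝ) ^ 2 := by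
    rw [Finset.card_powersetCard, hScard, Nat.choose_symm hN2]
    exact_mod_cast Nat.choose_le_pow N 2
  have htotal : ∑ T ∈ PC, ∑ x : TorusSite 3 L, field ψ T x ^ 2 ≤ (N : ℝ) ^ 5 := by
    calc ∑ T ∈ PC, ∑ x : TorusSite 3 L, field ψ T x ^ 2
        ≤ ∑ T ∈ PC, ∑ x : TorusSite 3 L, (if x ∈ S ∧ T ⊆ S then (1 : ℝ) else 0) * (N : ℝ) ^ 2 :=
          Finset.sum_le_sum fun T _ => Finset.sum_le_sum fun x _ => hsq_le T x
      _ = ∑ T ∈ PC, (if T ⊆ S then (1 : ℝ) else 0) * ((N : ℝ) * (N : ℝ) ^ 2) := by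
          refine Finset.sum_congr rfl fun T _ => ?_
          by_cases hT : T ⊆ S
          · rw [if_pos hT, one_mul]
            have : ∀ x : TorusSite 3 L, (if x ∈ S ∧ T ⊆ S then (1 : ℝ) else 0) * (N : ℝ) ^ 2 =
                (if x ∈ S then (1 : ℝ) else 0) * (N : ℝ) ^ 2 := by
              intro x
              by_cases hx : x ∈ S
              · rw [if_pos ⟨hx, hT⟩, if_pos hx]
              · rw [if_neg (fun h => hx h.1), if_neg hx]
            simp_rw [this]
            rw [← Finset.sum_mul, Finset.sum_boole]
            have hf : (Finset.univ.filter fun y : TorusSite 3 L => y ∈ S) = S := by ext y; simp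
            rw [hf, hScard]
          · rw [if_neg hT, zero_mul]
            refine Finset.sum_eq_zero fun x _ => ?_
            rw [if_neg (fun h => hT h.2), zero_mul]
      _ = ((PC.filter fun T => T ⊆ S).card : ℝ) * ((N : ℝ) * (N : ℝ) ^ 2) := by
          rw [← Finset.sum_mul, Finset.sum_boole]
      _ ≤ (N : ℝ) ^ 2 * ((N : ℝ) * (N : ℝ) ^ 2) := by
          rw [hPCfilter]
          exact mul_le_mul_of_nonneg_right hchoose (by positivity)
      _ = (N : ℝ) ^ 5 := by ring
  have htotal0 : 0 ≤ ∑ T ∈ PC, ∑ x : TorusSite 3 L, field ψ T x ^ 2 :=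
    Finset.sum_nonneg fun T _ => Finset.sum_nonneg fun x _ => by positivity
  have hexp : Real.exp (-(c₁ * ((N : ℝ) / (L : ℝ) ^ 3) * ((N : ℕ) : ℝ) ^ 3)) =
      Real.exp (-(c₁ * N / 64)) := by
    congr 1
    rw [hLdef]
    have hN0 : (N : ℝ) ≠ 0 := by
      have : (0 : ℝ) < N := by exact_mod_cast (show 0 < N by omega)
      exact this.ne'
    push_cast
    field_simp
    ring
  change ∑ T ∈ PC, ∑ x : TorusSite 3 L, g T x ≤
    C₁ * Real.exp (-(c₁ * ((N : ℝ) / (L : ℝ) ^ 3) * ((N : ℕ) : ℝ) ^ 3)) *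
      ∑ T ∈ PC, ∑ x : TorusSite 3 L, field ψ T x ^ 2 at key
  rw [hexp] at key
  have hE : 0 < Real.exp (-(c₁ * N / 64)) := Real.exp_pos _
  by_cases hC : C₁ ≤ 0
  · have : C₁ * Real.exp (-(c₁ * N / 64)) * ∑ T ∈ PC, ∑ x : TorusSite 3 L, field ψ T x ^ 2 ≤ 0 := by
      have h1 : C₁ * Real.exp (-(c₁ * N / 64)) ≤ 0 := mul_nonpos_of_nonpos_of_nonneg hC hE.le
      exact mul_nonpos_of_nonpos_of_nonneg h1 htotal0
    have hN3' : (3 : ℝ) ≤ N := by exact_mod_cast hN3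
    linarith
  · rw [not_le] at hC
    have h1 : C₁ * Real.exp (-(c₁ * N / 64)) * ∑ T ∈ PC, ∑ x : TorusSite 3 L, field ψ T x ^ 2 ≤
        C₁ * Real.exp (-(c₁ * N / 64)) * (N : ℝ) ^ 5 :=
      mul_le_mul_of_nonneg_left htotal (by positivity)
    have h2 : C₁ * Real.exp (-(c₁ * N / 64)) * (N : ℝ) ^ 5 =
        C₁ * (N : ℝ) ^ 5 * Real.exp (-(c₁ * N / 64)) := by ring
    linarith

end Summit.AtomisticToContinuum.BoseEinsteinCondensation.Theorems.InsertionFieldDelocalisation.Negative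

end
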